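import Summits.BirchSwinnertonDyer.BirchSwinnertonDyer.Theorems.AdditiveKolyvaginRoadRamifiedHabitatSignLawEven
import Summits.BirchSwinnertonDyer.BirchSwinnertonDyer.Theorems.AdditiveKolyvaginRoadRamifiedHabitatSignLawPotMult
import HarnessLib

/-!
# Route `AdditiveKolyvaginRoad`, crux KS′ `LevelKolyvaginSystemsAdditive` (stmt-BirchSwinnertonDyer-21396), card `ramified-toric-habitat` —
# the additive POTENTIALLY MULTIPLICATIVE row of the habitat for an EVEN habitat discriminant: the sign DEPENDS ON `D'`

Cell `pub/bsd-wall`, width seat `bsd-wall-akr-p2x-w3` g13; `--supports stmt-BirchSwinnertonDyer-21396` (helper). THEOREMS ONLY; no definition,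
no named fact, no `sorry`. BSD is not proved by any of this; KS′/KPA′ stay OPEN at `p² ∣ N`.

w2 g11's part 11 (`…RamifiedHabitatSignLawPotMult`, `rootNumber_mul_rootNumber_ramifiedTwist_of_potMult`): for `E` additive potentially
MULTIPLICATIVE at `p ≥ 5` (minimal model `ord_p c₄ = 2`, `ord_p Δ > 6`; `semistabilityDefectAt = 2 ∣ p − 1`) and the habitat `d = p*·d'` with
ODD `d'`, `w(E)·w(E^{(d)}) = −(d'/p)·W_p(E^{(p*)})` — the sign flips with the class of `d'` mod `p` (the datum behind evidence #41: the sketch's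
`SignLawPrincipalSeries` is misstated on these rows). Here the same for an EVEN cofactor `D' = 4m` (`m ≡ 2, 3 (4)` squarefree): `E' = E^{(p*)}`
is multiplicative at `p`, `N_{E'} = M·p` (the `k = 1` case of `rootNumber_mul_rootNumber_ramifiedTwist_of_four_dvd_of_pStar`), and

* `rootNumber_mul_rootNumber_ramifiedTwist_even_of_potMult` — **`w(E)·w(E^{(d)}) = −(D'/p)·W_p(E^{(p*)})`**, assuming ONLY the Modularity Theorem.

So for even habitats too the sign is NOT determined by `(E, p)`: both classes `(D'/p) = ±1` occur among the habitats.

References: [cite: MurtyMurty1997, Ch. 6 §1] [cite: Rohrlich1993Compositio, Prop. 2(ii),(iii)] [cite: KellockDokchitser2023, Rem. 2.2].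
-/

set_option autoImplicit false
set_option linter.dupNamespace false

noncomputable section

open scoped Classical MatrixGroups NumberTheorySymbols

open CongruenceSubgroup IsDedekindDomain IsDedekindDomain.HeightOneSpectrum NumberField Rat.HeightOneSpectrum
  WeierstrassCurve Literature.NumberTheory.EllipticCurves Literature.NumberTheory.EllipticCurves.ModularForms
  IsDiscreteValuationRing

namespace Summit.BirchSwinnertonDyer.BirchSwinnertonDyer.Theorems.AdditiveKoly.RamifiedHabitat

section EvenPotMult

variable {p : ℕ} [Fact p.Prime]

/-- **THE POTENTIALLY MULTIPLICATIVE ROW, EVEN HABITAT DISCRIMINANT: `w(E)·w(E^{(d)}) = −(D'/p)·W_p(E^{(p*)})`.** `E/ℚ` of conductor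
`N = M p²` (`p ≥ 5`, `M` squarefree, `p ∤ M`) whose minimal model at `p` has `ord_p c₄ = 2`, `ord_p Δ = a > 6` (additive, potentially
multiplicative); `d = p*·D'` with `D' = 4m` an EVEN fundamental discriminant prime to `N`, `d < 0`, every prime of `M` split in `ℚ(√d)`. Then,
assuming ONLY the Modularity Theorem, `w(E)·w(E^{(d)}) = −(D'/p)·W_p(E')`, `E' = E^{(p*)}` multiplicative at `p` (`W_p(E') = −1` split,
`+1` non-split): for fixed `E` the sign FLIPS with the class of `D'` mod `p`, exactly as for odd cofactors.
[cite: MurtyMurty1997, Ch. 6 §1] [cite: Rohrlich1993Compositio, Prop. 2(ii),(iii)] [cite: KellockDokchitser2023, Rem. 2.2] -/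
theorem rootNumber_mul_rootNumber_ramifiedTwist_even_of_potMult (W : WeierstrassCurve ℚ) [W.IsElliptic] (hmod : exists_isNewformOf)
    (hp5 : 5 ≤ p) {M : ℕ} (hN : W.conductorNorm ℤ = M * p ^ 2) (hM : Squarefree M) (hpM : ¬ p ∣ M) {a : ℕ}
    (hΔ : addVal ℤ_[p] (((W.baseChange ℚ_[p]).minimal ℤ_[p]).integralModel ℤ_[p]).Δ = a) (ha : 6 < a)
    (hc₄ : addVal ℤ_[p] (((W.baseChange ℚ_[p]).minimal ℤ_[p]).integralModel ℤ_[p]).c₄ = 2)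
    {D' : ℤ} (h4 : 4 ∣ D') (hm4 : D' / 4 % 4 = 2 ∨ D' / 4 % 4 = 3) (hsq : Squarefree (D' / 4))
    (hgcd : Int.gcd D' (W.conductorNorm ℤ) = 1) (hneg : (-1 : ℤ) ^ (p / 2) * p * D' < 0)
    (hsplit : ∀ q ∈ M.primeFactors, q ≠ 2 → J((-1 : ℤ) ^ (p / 2) * p * D' | q) = 1) :
    W.rootNumber * (W.quadraticTwist (((-1 : ℤ) ^ (p / 2) * p * D' : ℤ) : ℚ)).rootNumber =
      -legendreSym p D' * ((W.quadraticTwist (((-1 : ℤ) ^ (p / 2) * p : ℤ) : ℚ)).baseChange ℚ_[p]).localRootNumber ℤ_[p] := by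
  have hp : p.Prime := Fact.out
  have hp2 : p ≠ 2 := by omega
  have hdZ0 : ((-1 : ℤ) ^ (p / 2) * p : ℤ) ≠ 0 :=
    mul_ne_zero (pow_ne_zero _ (by norm_num)) (by exact_mod_cast hp.ne_zero)
  have hd0 : (((((-1 : ℤ) ^ (p / 2) * p : ℤ)) : ℚ)) ≠ 0 := by exact_mod_cast hdZ0
  haveI hE' : (W.quadraticTwist (((-1 : ℤ) ^ (p / 2) * p : ℤ) : ℚ)).IsElliptic := W.isElliptic_quadraticTwist hd0
  set w' := ((W.quadraticTwist (((-1 : ℤ) ^ (p / 2) * p : ℤ) : ℚ)).baseChange ℚ_[p]).localRootNumber ℤ_[p] with hw'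
  have hA : W.rootNumber * (W.quadraticTwist (((-1 : ℤ) ^ (p / 2) * p : ℤ) : ℚ)).rootNumber =
      legendreSym p M * (ZMod.χ₄ p * w') := by
    rw [rootNumber_mul_rootNumber_pStarTwist_of_potMult W hmod hp5 hN hM hpM hΔ ha hc₄, mul_assoc]
  obtain ⟨-, hmult, -⟩ := hasMultiplicativeReduction_pStarTwist_padic_of_potMult W hp5 hΔ ha hc₄
  have hN' : (W.quadraticTwist (((-1 : ℤ) ^ (p / 2) * p : ℤ) : ℚ)).conductorNorm ℤ = M * p ^ 1 := by
    rw [conductorNorm_pStarTwist_eq_mul_of_mult W hp5 hN hpM hmult, pow_one]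
  have hgcd' : Int.gcd D' (M * p ^ 1 : ℕ) = 1 := by
    have h1 := Int.isCoprime_iff_gcd_eq_one.mpr hgcd
    rw [hN] at h1
    rw [← Int.isCoprime_iff_gcd_eq_one]
    push_cast at h1 ⊢
    rw [sq, ← mul_assoc] at h1
    rw [pow_one]
    exact h1.of_mul_right_left
  rw [rootNumber_mul_rootNumber_ramifiedTwist_of_four_dvd_of_pStar W hmod hp2 hpM hN' hA h4 hm4 hsq hgcd' hneg hsplit, pow_one,
    ← jacobiSym.legendreSym.to_jacobiSym]
  linear_combination (-(legendreSym p D') * w') * χ₄_natCast_mul_self hp2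

end EvenPotMult

end Summit.BirchSwinnertonDyer.BirchSwinnertonDyer.Theorems.AdditiveKoly.RamifiedHabitat

end
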